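import Summits.QuantumFields.YangMills.Theorems.BalabanUVNodesN15TwoGridFirstOrderLetters
import Summits.QuantumFields.YangMills.Theorems.BalabanUVNodesN15BackgroundPropagator
import HarnessLib

/-!
# N15 (NE2) — PROGRAMME M-II «THE FIRST-ORDER LAYER BY PARTS», part II-C: ★★★ THE η-DEFECT OF THE VALUE OF THE FIRST-ORDER DRESSED PAIR WITH NO LETTER ON `∇c′` —
# `𝔇(X′, X) ≤ A·(1 − q′)⁻¹·e^{−ρd}` from `U ≡ 1` rows and the (3.35) letters `|c′|, |a′|, |∇′⁻a′| ≤ r, r_b` plus the fit of `a′` ONLY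

WHO ∕ WHEN.  Cell `pub-ymgap`, seat `pub-ymgap-dag-n15-a` (KNIT-BY-NAME seat of Track-A DAG node N15 = NE2, g24); `--kind proof --supports stmt-QuantumFields-27366 --as helper` (K3⁸;
count-neutral).  THEOREMS ONLY (0 `def`).  Over parts II-A `…TwoGridFirstOrderByParts` (★★★ `idef_firstOrder_fix`, `sD_sA_pull_law`), II-B `…TwoGridFirstOrderLetters` (`hasMaj_pull_sub_sA_pull_comp`,
`hasMaj_byPartsPiece`, `hasMaj_byPartsStep`, `bgPair_value_fix`, `bgPair_grad_eq`, `bgPair_value_fix'`, `hasMaj_bgPair_comp`, `hasMaj_mulOp_comp`, `hasMaj_comp_diagK_const`), M-C `…TwoGridCellMean`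
(★★ `hasMaj_comp_idef_mulOp_blockAvg_of_divAdj` — the zeroth-order coefficient defect from source-divergence rows, NO fit letter), n15-b A1 `…BackgroundPropagator` (`abs_blockAvg_le`),
`T4EtaRateCoeffDefect.hasMaj_idef_mulOp`, `B9SectDWeightedNeumann` (`wrow_of_exp`, `neumann_majorant_wrow`), `B11SectG.hasMaj_comp_exp`, part 3 `hasMaj_finsum` BY NAME; nothing modified.

THE PRINT (MECHANISM and SHAPES only; nothing of [B9] asserted).  [Balaban1985BackgroundPropagators] (3.52) p.400 (`Δ_A = Δ + V′(A)`, `V′` first order in `∇`), (3.62)–(3.65) pp.402–403 (the step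
bound, the Neumann series, the resolvent identity `G′(U′U) = G′(U) + G′(U)V′(A)G′(U′U)`), (3.35) p.396 («|A| < O(1)Mα₀(L^jη)^{−1}, |∇^ηA| < O(1)Mα₀(L^jη)^{−2}» — the letters of THIS file:
sup of the coefficients and of their FIRST difference quotients; p.396 L22–29 «for the operators introduced until now we need only (3.35)»).  [King1986] p.664 (the pairing `x′ ∈ B(x)`).

WHAT.  §19 ★★★ `hasMaj_idef_bgPairValue_of_letters`: on King's torus carriers (`n = L^k`, `n′ = L^mL^k`, pairing `kingPrV`), for coarse ∕ fine pieces `G, G′` with `U ≡ 1` rows — values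
`≤ βe^{−δd}`, gradient rows `∇G, ∇′G′ ≤ βe^{−δd}`, source-gradient rows `G′∇′_μ ≤ C₂e^{−δd}`, source-divergence rows `G′∇′*_κ ≤ C₁e^{−δd}`, the η-defect `𝔇(G′, G) ≤ m_Ge^{−δd}` — and a fine
first-order coefficient family `(c′, a′_μ)` with `|c′|, |a′_μ| ≤ r`, `|∇′⁻_μa′_μ| ≤ r_b`, `|a′_μ − ā_μ∘π| ≤ o_a` (`ā = blockAvg`), under the two contraction guards: the η-defect of the VALUES
of the dressed propagators `X′ = (1 − G′V₁′)⁻¹G′`, `X = (1 − GV₁)⁻¹G` (`V₁′ = M_{c′} + Σ_μ M_{a′_μ}∇′_μ`, coarse partner `(c̄, ā) = blockAvg`, realised as the value components of n15-b's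
`bgPair`) obeys `𝔇(X′, X) ≤ A·(1 − q′)⁻¹·e^{−ρd}` with
`A = m_G(1 + r(d+2)β_Xc_r) + 2(d+1)rL^{−k}C₁β_Xc_r + (d+1)(C₂r + βr_b)L^{−k}β_Xc_r + (d+1)βo_aβ_Xc_r`, `β_X = β(1 − βr(d+2)c_r)⁻¹`, `q′ = (βr + (d+1)(C₂r + βr_b))c_r` —
EVERY summand of `A` carries a rate factor (`m_G`, `L^{−k}`, `o_a`); NO letter on `∇c′`, `∇∇a′`, no fit of `c′`.
HOW.  II-A's exact identity `𝔇₀ = S + (G′V₁′)𝔇₀`; the four summands of `S` bounded by II-B ∕ M-C letters and composed at the rate `ρ` (`hasMaj_comp_exp`); `neumann_majorant_wrow`.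

HONEST FRAMING ∕ LIMITS.  Entry 0 (values) of the pair only — the gradient ∕ divergence ∕ Laplacian entries of a dressed pair need the mixed row `∇G∇*` (located obstruction, n15-b §4);
block-majorant bookkeeping over hypothesis-shaped `U ≡ 1` data (the sequel instantiates them at Bałaban's `(Δ′_a⁻¹, Δ_a⁻¹)` hypothesis-free); abelianised scalar-multiplier
coefficients (MODEL of (3.52)'s `V′(A)`); NE2⁺ NOT printed ∕ proved; no statement of record touched; N15 NOT discharged; K3⁸ OPEN; counts UNMOVED (typed 28∕28 · discharged 5∕27);
NOT infinite volume ∕ OS ∕ mass gap ∕ Clay.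
-/

noncomputable section

open scoped BigOperators
open Finset

namespace Summit.QuantumFields.YangMills.BalabanUVNodes.N15.TwoGrid

open Literature.MathematicalPhysics.QuantumFieldTheory.Balaban1983to89
open Literature.MathematicalPhysics.QuantumFieldTheory.Balaban1983to89.B11SectG (BlockNorm HasMaj hasMaj_comp hasMaj_comp_exp RowSum)
open Literature.MathematicalPhysics.QuantumFieldTheory.Balaban1983to89.T4EtaRateDefect (idef)
open Literature.MathematicalPhysics.QuantumFieldTheory.Balaban1983to89.T4EtaRateCoeffDefect (pull pull_apply diagK blockAvg hasMaj_idef_mulOp)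
open Literature.MathematicalPhysics.QuantumFieldTheory.Balaban1983to89.B9SectDWeightedNeumann (WRow wrow_of_exp neumann_majorant_wrow)
open Literature.MathematicalPhysics.QuantumFieldTheory.Balaban1983to89.B6RandomWalk (Triangle254)
open Literature.MathematicalPhysics.QuantumFieldTheory.Balaban1983to89.B6Prop26Gluing (mulOp mulOp_apply)
open Literature.MathematicalPhysics.QuantumFieldTheory.Balaban1983to89.B5Prop11Plancherel (Tor fine unitVec)
open Literature.MathematicalPhysics.QuantumFieldTheory.King1986.Torus (blockOf tdistT tdistT_nonneg)
open Literature.MathematicalPhysics.QuantumFieldTheory.Balaban1983to89.B6UnitTorusCarrier (unitTorusGeo triangle254_unitTorusGeo)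
open Summit.QuantumFields.YangMills.BalabanUVNodes.N15.VectorPiece (blkFine kingPrV blkFine_comp_kingPrV)
open Summit.QuantumFields.YangMills.BalabanUVNodes.N15.BackgroundModel (kappa_ofBlocks)
open Summit.QuantumFields.YangMills.BalabanUVNodes.N15.DerivDefect (exists_const_hasMaj_ofBlocks)
open Summit.QuantumFields.YangMills.BalabanUVNodes.N15.BackgroundLayer (bgPair projO abs_blockAvg_le)

variable {d : ℕ}

/-! ## §19 ★★★ The value defect of the first-order dressed pair from letters -/

section Main

variable {L : ℕ} [NeZero L] (M : Fin (d + 1) → ℕ) [∀ μ, NeZero (M μ)] (k m : ℕ)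

/-- ★★★ **THE η-DEFECT OF THE VALUES OF THE FIRST-ORDER DRESSED PAIR, NO LETTER ON `∇c′`.**  See the module docstring (WHAT) for the reading; the letters are the hypotheses `hG … hfa`, the
guards `hq` (the jets' Neumann series) and `hqK` (the fine by-parts step's weighted row norm). [cite: Balaban1985BackgroundPropagators, (3.52) p.400, (3.62)–(3.65) pp.402–403 (mechanism), (3.35) p.396 (letters); King1986, p.664 (pairing)] -/
theorem hasMaj_idef_bgPairValue_of_letters {σ cr : ℝ} (hσ : 0 ≤ σ) (hcr : 0 ≤ cr) (hrow : RowSum (unitTorusGeo L k M) σ cr) {ρ δ β C₁ C₂ mG r rb oa : ℝ} (hρ : 0 ≤ ρ)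
    (hρδ : ρ + σ ≤ δ) (hβ : 0 ≤ β) (hC₁ : 0 ≤ C₁) (hC₂ : 0 ≤ C₂) (hmG : 0 ≤ mG) (hr : 0 ≤ r) (hrb : 0 ≤ rb) (hoa : 0 ≤ oa)
    {G : (Tor (fine (L ^ k) M) × Fin (d + 1) → ℝ) →ₗ[ℝ] (Tor (fine (L ^ k) M) × Fin (d + 1) → ℝ)}
    {G' : (Tor (fine (L ^ m * L ^ k) M) × Fin (d + 1) → ℝ) →ₗ[ℝ] (Tor (fine (L ^ m * L ^ k) M) × Fin (d + 1) → ℝ)}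
    {c' : Tor (fine (L ^ m * L ^ k) M) × Fin (d + 1) → ℝ} {a' : Fin (d + 1) → Tor (fine (L ^ m * L ^ k) M) × Fin (d + 1) → ℝ}
    (hG : HasMaj (BlockNorm.ofBlocks (unitTorusGeo L k M) (blkFine L k M)) (BlockNorm.ofBlocks (unitTorusGeo L k M) (blkFine L k M)) G
      (fun y y' => β * Real.exp (-(δ * tdistT M y y'))))
    (hGD : ∀ μ, HasMaj (BlockNorm.ofBlocks (unitTorusGeo L k M) (blkFine L k M)) (BlockNorm.ofBlocks (unitTorusGeo L k M) (blkFine L k M))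
      (symbOp M (L ^ k) (sD M (L ^ k) μ ((L ^ k : ℕ) : ℝ)) ∘ₗ G) (fun y y' => β * Real.exp (-(δ * tdistT M y y'))))
    (hG' : HasMaj (BlockNorm.ofBlocks (unitTorusGeo L k M) (fun i : Tor (fine (L ^ m * L ^ k) M) × Fin (d + 1) => blockOf (L ^ m * L ^ k) M i.1))
      (BlockNorm.ofBlocks (unitTorusGeo L k M) (fun i : Tor (fine (L ^ m * L ^ k) M) × Fin (d + 1) => blockOf (L ^ m * L ^ k) M i.1)) G'
      (fun y y' => β * Real.exp (-(δ * tdistT M y y'))))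
    (hG'D : ∀ μ, HasMaj (BlockNorm.ofBlocks (unitTorusGeo L k M) (fun i : Tor (fine (L ^ m * L ^ k) M) × Fin (d + 1) => blockOf (L ^ m * L ^ k) M i.1))
      (BlockNorm.ofBlocks (unitTorusGeo L k M) (fun i : Tor (fine (L ^ m * L ^ k) M) × Fin (d + 1) => blockOf (L ^ m * L ^ k) M i.1))
      (symbOp M (L ^ m * L ^ k) (sD M (L ^ m * L ^ k) μ ((L ^ m * L ^ k : ℕ) : ℝ)) ∘ₗ G') (fun y y' => β * Real.exp (-(δ * tdistT M y y'))))
    (hG'grad : ∀ μ, HasMaj (BlockNorm.ofBlocks (unitTorusGeo L k M) (fun i : Tor (fine (L ^ m * L ^ k) M) × Fin (d + 1) => blockOf (L ^ m * L ^ k) M i.1))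
      (BlockNorm.ofBlocks (unitTorusGeo L k M) (fun i : Tor (fine (L ^ m * L ^ k) M) × Fin (d + 1) => blockOf (L ^ m * L ^ k) M i.1))
      (G' ∘ₗ symbOp M (L ^ m * L ^ k) (sD M (L ^ m * L ^ k) μ ((L ^ m * L ^ k : ℕ) : ℝ))) (fun y y' => C₂ * Real.exp (-(δ * tdistT M y y'))))
    (hG'div : ∀ κ : Fin (d + 1), HasMaj (BlockNorm.ofBlocks (unitTorusGeo L k M) (fun i : Tor (fine (L ^ m * L ^ k) M) × Fin (d + 1) => blockOf (L ^ m * L ^ k) M i.1))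
      (BlockNorm.ofBlocks (unitTorusGeo L k M) (fun i : Tor (fine (L ^ m * L ^ k) M) × Fin (d + 1) => blockOf (L ^ m * L ^ k) M i.1))
      (G' ∘ₗ symbOp M (L ^ m * L ^ k) (((L ^ m * L ^ k : ℕ) : ℝ) • (sTinv M (L ^ m * L ^ k) κ - 1))) (fun y y' => C₁ * Real.exp (-(δ * tdistT M y y'))))
    (hDG : HasMaj (BlockNorm.ofBlocks (unitTorusGeo L k M) (blkFine L k M))
      (BlockNorm.ofBlocks (unitTorusGeo L k M) (fun i : Tor (fine (L ^ m * L ^ k) M) × Fin (d + 1) => blockOf (L ^ m * L ^ k) M i.1))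
      (idef (pull (kingPrV L k m M)) (pull (kingPrV L k m M)) G' G) (fun y y' => mG * Real.exp (-(δ * tdistT M y y'))))
    (hc' : ∀ z, |c' z| ≤ r) (ha' : ∀ μ z, |a' μ z| ≤ r)
    (hb' : ∀ μ z, |((L ^ m * L ^ k : ℕ) : ℝ) * (a' μ z - a' μ (z.1 - unitVec (fine (L ^ m * L ^ k) M) μ, z.2))| ≤ rb)
    (hfa : ∀ μ z, |a' μ z - blockAvg (kingPrV L k m M) (a' μ) (kingPrV L k m M z)| ≤ oa)
    (hq : β * (r * (d + 2)) * cr < 1) (hqK : (β * r + (d + 1) * (C₂ * r + β * rb)) * cr < 1) :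
    HasMaj (BlockNorm.ofBlocks (unitTorusGeo L k M) (blkFine L k M))
      (BlockNorm.ofBlocks (unitTorusGeo L k M) (fun i : Tor (fine (L ^ m * L ^ k) M) × Fin (d + 1) => blockOf (L ^ m * L ^ k) M i.1))
      (idef (pull (kingPrV L k m M)) (pull (kingPrV L k m M))
        (projO none ∘ₗ bgPair G' (fun μ => symbOp M (L ^ m * L ^ k) (sD M (L ^ m * L ^ k) μ ((L ^ m * L ^ k : ℕ) : ℝ)) ∘ₗ G') c' a')
        (projO none ∘ₗ bgPair G (fun μ => symbOp M (L ^ k) (sD M (L ^ k) μ ((L ^ k : ℕ) : ℝ)) ∘ₗ G) (blockAvg (kingPrV L k m M) c')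
          (fun μ => blockAvg (kingPrV L k m M) (a' μ))))
      (fun y y' =>
        (mG * (1 + r * (d + 2) * (β * (1 - β * (r * (d + 2)) * cr)⁻¹) * cr) + 2 * (d + 1) * r * (((L ^ k : ℕ) : ℝ))⁻¹ * C₁ * (β * (1 - β * (r * (d + 2)) * cr)⁻¹) * cr +
            (d + 1) * ((C₂ * r + β * rb) * ((((L ^ k : ℕ) : ℝ))⁻¹ * (β * (1 - β * (r * (d + 2)) * cr)⁻¹)) * cr) +
            (d + 1) * (β * oa * (β * (1 - β * (r * (d + 2)) * cr)⁻¹) * cr)) *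
          (1 - (β * r + (d + 1) * (C₂ * r + β * rb)) * cr)⁻¹ * Real.exp (-(ρ * tdistT M y y'))) := by
  -- geometry and bookkeeping
  have htri : Triangle254 (unitTorusGeo L k M) := triangle254_unitTorusGeo L k M
  have hd : ∀ a b : (unitTorusGeo L k M).Site, 0 ≤ (unitTorusGeo L k M).dist a b := fun a b => tdistT_nonneg M a b
  have hρδ' : ρ ≤ δ := by linarith
  have hn0 : (0 : ℝ) ≤ (((L ^ k : ℕ) : ℝ))⁻¹ := by positivity
  have hq0 : 0 < 1 - β * (r * (d + 2)) * cr := by linarith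
  set βX : ℝ := β * (1 - β * (r * (d + 2)) * cr)⁻¹ with hβX_def
  have hβX : 0 ≤ βX := mul_nonneg hβ (inv_nonneg.2 hq0.le)
  set θK : ℝ := β * r + (d + 1) * (C₂ * r + β * rb) with hθK_def
  have hθK : 0 ≤ θK := by positivity
  have hR : r * (1 + (Fintype.card (Fin (d + 1)) : ℝ)) ≤ r * (d + 2) := by rw [Fintype.card_fin]; push_cast; exact le_of_eq (by ring)
  -- names
  set P := pull (kingPrV L k m M) with hP_def
  set bc := BlockNorm.ofBlocks (unitTorusGeo L k M) (blkFine L k M) with hbc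
  set bf := BlockNorm.ofBlocks (unitTorusGeo L k M) (fun i : Tor (fine (L ^ m * L ^ k) M) × Fin (d + 1) => blockOf (L ^ m * L ^ k) M i.1) with hbf
  set Dc : Fin (d + 1) → (Tor (fine (L ^ k) M) × Fin (d + 1) → ℝ) →ₗ[ℝ] (Tor (fine (L ^ k) M) × Fin (d + 1) → ℝ) :=
    fun μ => symbOp M (L ^ k) (sD M (L ^ k) μ ((L ^ k : ℕ) : ℝ)) with hDc
  set Df : Fin (d + 1) → (Tor (fine (L ^ m * L ^ k) M) × Fin (d + 1) → ℝ) →ₗ[ℝ] (Tor (fine (L ^ m * L ^ k) M) × Fin (d + 1) → ℝ) :=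
    fun μ => symbOp M (L ^ m * L ^ k) (sD M (L ^ m * L ^ k) μ ((L ^ m * L ^ k : ℕ) : ℝ)) with hDf
  set Af : Fin (d + 1) → (Tor (fine (L ^ m * L ^ k) M) × Fin (d + 1) → ℝ) →ₗ[ℝ] (Tor (fine (L ^ m * L ^ k) M) × Fin (d + 1) → ℝ) :=
    fun μ => symbOp M (L ^ m * L ^ k) (sA M (L ^ m * L ^ k) μ (L ^ m)) with hAf
  set c : Tor (fine (L ^ k) M) × Fin (d + 1) → ℝ := blockAvg (kingPrV L k m M) c' with hc_def
  set a : Fin (d + 1) → Tor (fine (L ^ k) M) × Fin (d + 1) → ℝ := fun μ => blockAvg (kingPrV L k m M) (a' μ) with ha_def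
  set Xv := projO none ∘ₗ bgPair G (fun μ => Dc μ ∘ₗ G) c a with hXv_def
  set Y : Fin (d + 1) → (Tor (fine (L ^ k) M) × Fin (d + 1) → ℝ) →ₗ[ℝ] (Tor (fine (L ^ k) M) × Fin (d + 1) → ℝ) :=
    fun μ => projO (some μ) ∘ₗ bgPair G (fun μ => Dc μ ∘ₗ G) c a with hY_def
  set Xv' := projO none ∘ₗ bgPair G' (fun μ => Df μ ∘ₗ G') c' a' with hXv'_def
  -- coarse coefficients
  have hc : ∀ x, |c x| ≤ r := abs_blockAvg_le (kingPrV L k m M) hr hc'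
  have ha : ∀ μ x, |a μ x| ≤ r := fun μ => abs_blockAvg_le (kingPrV L k m M) hr (ha' μ)
  -- the coarse jet (II-B §18) and the fine unit
  have hJc := fun j => hasMaj_bgPair_comp (g := unitTorusGeo L k M) (blkFine L k M) (Dc := Dc) htri hd hrow hσ hρ hρδ hβ hr hG hGD hc ha hR hq j
  have hunit := (hJc none).1
  have hXv : HasMaj bc bc Xv (fun y y' => βX * Real.exp (-(ρ * tdistT M y y'))) := (hJc none).2
  have hYb : ∀ μ, HasMaj bc bc (Y μ) (fun y y' => βX * Real.exp (-(ρ * tdistT M y y'))) := fun μ => (hJc (some μ)).2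
  have hunit' := (hasMaj_bgPair_comp (g := unitTorusGeo L k M) (fun i : Tor (fine (L ^ m * L ^ k) M) × Fin (d + 1) => blockOf (L ^ m * L ^ k) M i.1) (Dc := Df)
    htri hd hrow hσ hρ hρδ hβ hr hG' hG'D hc' ha' hR hq none).1
  -- the structural facts II-A consumes
  have hfix : Xv = G + G ∘ₗ (mulOp c ∘ₗ Xv + ∑ μ, mulOp (a μ) ∘ₗ Y μ) := bgPair_value_fix hunit
  have hYeq : ∀ μ, Y μ = Dc μ ∘ₗ Xv := fun μ => bgPair_grad_eq hunit μ
  have hfix' : Xv' = G' + G' ∘ₗ ((mulOp c' + ∑ μ, mulOp (a' μ) ∘ₗ Df μ) ∘ₗ Xv') := bgPair_value_fix' hunit'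
  have hPA : ∀ μ, Df μ ∘ₗ (Af μ ∘ₗ P) = P ∘ₗ Dc μ := fun μ => sD_sA_pull_law M L k m μ
  -- ★★★ THE EXACT IDENTITY (II-A)
  have hID := idef_firstOrder_fix (kingPrV L k m M) G Xv Y Dc c a G' Xv' Df Af c' a' hfix hfix' hYeq hPA
  -- THE STEP and its weighted row norm (II-B §17)
  have hK : HasMaj bf bf (G' ∘ₗ (mulOp c' + ∑ μ, mulOp (a' μ) ∘ₗ Df μ)) (fun y y' => θK * Real.exp (-(δ * tdistT M y y'))) :=
    hasMaj_byPartsStep M k (L ^ m * L ^ k) hβ hC₂ hr hr hrb hG' hG'grad hc' ha' hb'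
  have hwrow : WRow (unitTorusGeo L k M) ρ (fun y y' => θK * Real.exp (-(δ * tdistT M y y'))) (θK * cr) := wrow_of_exp (g := unitTorusGeo L k M) hd hrow hθK hρδ
  -- THE SOURCE TERM `S`, summand by summand
  -- (s1) `𝔇(G′,G)∘(1 + W)`
  have hS1a : HasMaj bc bf (idef P P G' G) (fun y y' => mG * Real.exp (-(ρ * tdistT M y y'))) :=
    hDG.mono fun y y' => mul_le_mul_of_nonneg_left (Real.exp_le_exp.mpr (by nlinarith [hd y y'])) hmG
  have hW1 : HasMaj bc bc (mulOp c ∘ₗ Xv) (fun y y' => r * (βX * Real.exp (-(ρ * tdistT M y y')))) :=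
    hasMaj_mulOp_comp (g := unitTorusGeo L k M) (blkFine L k M) (fun _ _ => mul_nonneg hβX (Real.exp_nonneg _)) hr hc hXv
  have hW2 := hasMaj_finsum (b₁ := bc) (b₂ := bc) Finset.univ (fun μ => mulOp (a μ) ∘ₗ Y μ) (fun _ y y' => r * (βX * Real.exp (-(ρ * tdistT M y y'))))
    fun μ _ => hasMaj_mulOp_comp (g := unitTorusGeo L k M) (blkFine L k M) (fun _ _ => mul_nonneg hβX (Real.exp_nonneg _)) hr (ha μ) (hYb μ)
  have hW : HasMaj bc bc (mulOp c ∘ₗ Xv + ∑ μ, mulOp (a μ) ∘ₗ Y μ) (fun y y' => r * (d + 2) * βX * Real.exp (-(ρ * tdistT M y y'))) := by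
    refine (hW1.add hW2).mono fun y y' => le_of_eq ?_
    rw [sum_const, card_univ, Fintype.card_fin, nsmul_eq_mul]
    push_cast
    ring
  have hrβ : 0 ≤ r * (d + 2) * βX := by positivity
  have hS1b := hasMaj_comp_exp (b₁ := bc) (b₂ := bc) (b₃ := bf) htri hd hrow hmG hrβ hρ le_rfl hρδ hDG hW
  have hS1 : HasMaj bc bf (idef P P G' G ∘ₗ (LinearMap.id + (mulOp c ∘ₗ Xv + ∑ μ, mulOp (a μ) ∘ₗ Y μ)))
      (fun y y' => mG * Real.exp (-(ρ * tdistT M y y')) + bc.κ * mG * (r * (d + 2) * βX) * cr * Real.exp (-(ρ * tdistT M y y'))) := by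
    rw [LinearMap.comp_add, LinearMap.comp_id]
    exact hS1a.add hS1b
  -- (s2) `G′∘𝔇(M_{c′}, M_{c̄})∘X` — THE SANDWICHED ZEROTH-ORDER COEFFICIENT DEFECT, NO fit letter (M-C)
  have hDV0 := hasMaj_comp_idef_mulOp_blockAvg_of_divAdj M k m (K := fun y y' => C₁ * Real.exp (-(δ * tdistT M y y')))
    (fun _ _ => mul_nonneg hC₁ (Real.exp_nonneg _)) hr hc' hG'div
  have hDV1 : HasMaj bc bf (G' ∘ₗ idef P P (mulOp c') (mulOp c)) (fun y y' => 2 * (d + 1) * r * (((L ^ k : ℕ) : ℝ))⁻¹ * C₁ * Real.exp (-(δ * (unitTorusGeo L k M).dist y y'))) :=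
    hDV0.mono fun y y' => le_of_eq (by ring)
  have h2c : 0 ≤ 2 * (d + 1) * r * (((L ^ k : ℕ) : ℝ))⁻¹ * C₁ := by positivity
  have hS2' := hasMaj_comp_exp (b₁ := bc) (b₂ := bc) (b₃ := bf) htri hd hrow h2c hβX hρ le_rfl hρδ hDV1 hXv
  have hS2 : HasMaj bc bf (G' ∘ₗ (idef P P (mulOp c') (mulOp c) ∘ₗ Xv))
      (fun y y' => bc.κ * (2 * (d + 1) * r * (((L ^ k : ℕ) : ℝ))⁻¹ * C₁) * βX * cr * Real.exp (-(ρ * tdistT M y y'))) := by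
    rw [← LinearMap.comp_assoc]
    exact hS2'
  -- (s3) `Σ_μ (G′M_{a′}∇′_μ)∘(P − A′_μP)∘X` — by parts, THE FACE TERM COSTS `L^{−k}`
  have hS3 : ∀ μ, HasMaj bc bf ((G' ∘ₗ (mulOp (a' μ) ∘ₗ Df μ)) ∘ₗ ((P - Af μ ∘ₗ P) ∘ₗ Xv))
      (fun y y' => bf.κ * (C₂ * r + β * rb) * ((((L ^ k : ℕ) : ℝ))⁻¹ * βX) * cr * Real.exp (-(ρ * tdistT M y y'))) := by
    intro μ
    have hO := hasMaj_byPartsPiece M k (L ^ m * L ^ k) hβ hC₂ hr hrb μ hG' (hG'grad μ) (ha' μ) (hb' μ)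
    have hT : HasMaj bc bc (symbOp M (L ^ k) (sD M (L ^ k) μ ((L ^ k : ℕ) : ℝ)) ∘ₗ Xv) (fun y y' => βX * Real.exp (-(ρ * tdistT M y y'))) := by
      have h := hYb μ
      rw [hYeq μ] at h
      exact h
    have hF0 := hasMaj_pull_sub_sA_pull_comp M k m (fun _ _ => mul_nonneg hβX (Real.exp_nonneg _)) μ hT
    have hF : HasMaj bc bf ((P - Af μ ∘ₗ P) ∘ₗ Xv) (fun y y' => (((L ^ k : ℕ) : ℝ))⁻¹ * βX * Real.exp (-(ρ * (unitTorusGeo L k M).dist y y'))) :=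
      hF0.mono fun y y' => le_of_eq (by ring)
    have hpos : 0 ≤ C₂ * r + β * rb := by positivity
    exact hasMaj_comp_exp (b₁ := bc) (b₂ := bf) (b₃ := bf) htri hd hrow hpos (mul_nonneg hn0 hβX) hρ le_rfl hρδ hO hF
  -- (s4) `Σ_μ G′∘𝔇(M_{a′}, M_{ā})∘Y_μ` — the legitimate fit of the first-order coefficient
  have hS4 : ∀ μ, HasMaj bc bf (G' ∘ₗ (idef P P (mulOp (a' μ)) (mulOp (a μ)) ∘ₗ Y μ))
      (fun y y' => bc.κ * (β * oa) * βX * cr * Real.exp (-(ρ * tdistT M y y'))) := by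
    intro μ
    have hfit := hasMaj_idef_mulOp (g := unitTorusGeo L k M) (blkFine L k M) (kingPrV L k m M) (a' := a' μ) (a := a μ) (o := fun _ => oa) (fun _ => hoa)
      fun z => hfa μ z
    rw [blkFine_comp_kingPrV] at hfit
    have hO : HasMaj bc bf (G' ∘ₗ idef P P (mulOp (a' μ)) (mulOp (a μ))) (fun y y' => β * oa * Real.exp (-(δ * (unitTorusGeo L k M).dist y y'))) :=
      hasMaj_comp_diagK_const (g := unitTorusGeo L k M) (fun i : Tor (fine (L ^ m * L ^ k) M) × Fin (d + 1) => blockOf (L ^ m * L ^ k) M i.1) (blkFine L k M) hβ hG' hfit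
    have h := hasMaj_comp_exp (b₁ := bc) (b₂ := bc) (b₃ := bf) htri hd hrow (mul_nonneg hβ hoa) hβX hρ le_rfl hρδ hO (hYb μ)
    rw [← LinearMap.comp_assoc]
    exact h
  have hS34 := hasMaj_finsum (b₁ := bc) (b₂ := bf) Finset.univ
    (fun μ => (G' ∘ₗ (mulOp (a' μ) ∘ₗ Df μ)) ∘ₗ ((P - Af μ ∘ₗ P) ∘ₗ Xv) + G' ∘ₗ (idef P P (mulOp (a' μ)) (mulOp (a μ)) ∘ₗ Y μ))
    (fun _ y y' => bf.κ * (C₂ * r + β * rb) * ((((L ^ k : ℕ) : ℝ))⁻¹ * βX) * cr * Real.exp (-(ρ * tdistT M y y')) +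
      bc.κ * (β * oa) * βX * cr * Real.exp (-(ρ * tdistT M y y')))
    fun μ _ => (hS3 μ).add (hS4 μ)
  -- `S` altogether
  set A : ℝ := mG * (1 + r * (d + 2) * βX * cr) + 2 * (d + 1) * r * (((L ^ k : ℕ) : ℝ))⁻¹ * C₁ * βX * cr +
      (d + 1) * ((C₂ * r + β * rb) * ((((L ^ k : ℕ) : ℝ))⁻¹ * βX) * cr) + (d + 1) * (β * oa * βX * cr) with hA_def
  have hA : 0 ≤ A := by positivity
  have hS : HasMaj bc bf
      ((idef P P G' G ∘ₗ (LinearMap.id + (mulOp c ∘ₗ Xv + ∑ μ, mulOp (a μ) ∘ₗ Y μ)))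
        + G' ∘ₗ (idef P P (mulOp c') (mulOp c) ∘ₗ Xv)
        + ∑ μ, ((G' ∘ₗ (mulOp (a' μ) ∘ₗ Df μ)) ∘ₗ ((P - Af μ ∘ₗ P) ∘ₗ Xv) + G' ∘ₗ (idef P P (mulOp (a' μ)) (mulOp (a μ)) ∘ₗ Y μ)))
      (fun y y' => A * Real.exp (-(ρ * tdistT M y y'))) := by
    refine ((hS1.add hS2).add hS34).mono fun y y' => le_of_eq ?_
    rw [sum_const, card_univ, Fintype.card_fin, nsmul_eq_mul, hA_def]
    simp only [hbc, hbf, kappa_ofBlocks]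
    push_cast
    ring
  -- a priori bound on the finite lattice, and the Neumann majorant
  obtain ⟨M₀, hM₀, hap⟩ := exists_const_hasMaj_ofBlocks (g := unitTorusGeo L k M) (blkFine L k M)
    (fun i : Tor (fine (L ^ m * L ^ k) M) × Fin (d + 1) => blockOf (L ^ m * L ^ k) M i.1) (idef P P Xv' Xv)
  have hq2 : bf.κ * (θK * cr) < 1 := by rw [hbf, kappa_ofBlocks, one_mul]; exact hqK
  have key := neumann_majorant_wrow htri hd hρ (fun _ _ => mul_nonneg hθK (Real.exp_nonneg _)) hwrow hA hM₀ hK hS hID hap hq2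
  refine key.mono fun y y' => le_of_eq ?_
  rw [hbf, kappa_ofBlocks, one_mul]

end Main

end Summit.QuantumFields.YangMills.BalabanUVNodes.N15.TwoGrid

end
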